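import Mathlib
import HarnessLib
import Literature.AlgebraicGeometry.Resolution.BlowupPrincipalCharts

/-!
# S1a — R4c cusp COVER bricks: sections PINNED to the same base section on two principal charts have the same zero set on the
# overlap; a point of `X′[U, y₁]` where the pinned ratio `y₀/y₁` is invertible lies in `X′[U, y₀]`

[OURS · L1 W4.5c · leafhand-res-wildquotients-7 g0; folklore chart-transition facts in the tree's `blowupChart` language (Literature
`BlowupPrincipalCharts`), companions of ✓`mem_basicOpen_of_mem_blowupChart_of_mul_appLE_eq` (`…S1aChartTransition`)] — NOT statements of the
manuscript; counted 0; AI-level work, weaker than expert review. Crux stmt-ResolutionOfSingularities-17941 `CyclicQuotientFourfolds`, line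
`s1a-logminvertex` v13 (`stub_reachLowerInFX`), R4c `cusp_killsIn_two` (crux-dir skeleton v2, `Lines/s1a_logminvertex-R4c-PROGRESS-v2.md`, COVER
obligation: "residual points" `z₀ = z₁ = 0` of a producer chart `O′ᵢⱼ` must be placed in a member chart; the residual sections `z₀ = u₀′^{n₀}/cⱼ`,
`z₁ = t̂ⁿ/cⱼ` of the charts `j` and `j′` at the same point are both PINNED to the same pulled-back base section (`z · π^*cⱼ = π^*(x₀^{n₀})`, resp.
`π^*(tⁿ)`), so the two scheme translations below transport "residual" across charts and move a residual point of `O′₀₂` into `O′₀₁`).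

* `isUnit_ratio_of_isPrincipalChart_pair` — on an affine open which is a principal chart for both `y₀` and `y₁`, the ratio `c` with
  `π^*y₀ = c · π^*y₁` is a unit;
* ★ `mem_basicOpen_iff_of_pins` — if `z₀ · π^*y₀ = π^*s` on `W₀ ⊆ X′[U, y₀]` and `z₁ · π^*y₁ = π^*s` on `W₁ ⊆ X′[U, y₁]`, then at every point of
  `W₀ ∩ W₁`: `v ∈ D(z₀) ↔ v ∈ D(z₁)` (the two "residual sections" `s/y₀`, `s/y₁` differ by the unit `y₁/y₀`);
* ★ `mem_blowupChart_of_mem_basicOpen_of_mul_appLE_eq` — converse of ✓`mem_basicOpen_of_mem_blowupChart_of_mul_appLE_eq`: if `z · π^*y₁ = π^*y₀` on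
  `W ⊆ X′[U, y₁]`, then every point of `W ∩ D(z)` lies in `X′[U, y₀]` (there `π^*y₀ = z · π^*y₁` is again a regular generator of `I·𝒪`).
-/

set_option linter.dupNamespace false

noncomputable section

universe u

open CategoryTheory AlgebraicGeometry TopologicalSpace Opposite
open Literature.AlgebraicGeometry.Resolution

namespace Summit.ResolutionOfSingularities.ResolutionOfSingularities.Theorems.WildQuotientResolution.S1.BlowupCharts

variable {X' X : Scheme.{u}} {π : X' ⟶ X} {I : X.IdealSheafData} (hπ : IsBlowup π I) (U : X.affineOpens)

/-- **On an affine open which is a principal chart for both `y₀` and `y₁`, the ratio `y₀/y₁` is a unit**: if `π^*y₀ = c · π^*y₁` on `B`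
then `c` is invertible (also `π^*y₁ = c′ · π^*y₀`, and `π^*y₁` is a nonzerodivisor, so `c′c = 1`). [OURS · L1 W4.5c · R4c; folklore, Stacks 0804] -/
theorem isUnit_ratio_of_isPrincipalChart_pair {y₀ y₁ : Γ(X, U)} (hy₁ : y₁ ∈ I.ideal U)
    {B : X'.affineOpens} (h₁ : IsPrincipalChart π I U y₁ B) (h₀ : IsPrincipalChart π I U y₀ B)
    {c : Γ(X', B)} (hc : π.appLE U B h₁.le_preimage y₀ = c * π.appLE U B h₁.le_preimage y₁) : IsUnit c := by
  obtain ⟨c', hc'⟩ := h₀.exists_eq_mul hy₁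
  obtain ⟨h, hnzd, -⟩ := id h₁
  -- `π^*y₁ · (1 - c′c) = 0`
  have h0 : π.appLE U B h y₁ * (1 - c' * c) = 0 := by
    have e : π.appLE U B h y₁ = c' * (c * π.appLE U B h y₁) := by rw [← hc]; exact hc'
    linear_combination e
  have h1 : (1 : Γ(X', B)) - c' * c = 0 := (mul_cancel_left_mem_nonZeroDivisors hnzd).mp (h0.trans (mul_zero _).symm)
  exact IsUnit.of_mul_eq_one_right c' (by linear_combination -h1)

include hπ in
/-- ★ **Sections pinned to the same base section on two charts have the same zero set on the overlap.** If `z₀ · π^*y₀ = π^*s` on an open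
`W₀ ⊆ X′[U, y₀]` and `z₁ · π^*y₁ = π^*s` on an open `W₁ ⊆ X′[U, y₁]` (`y₀, y₁ ∈ I(U)`), then for every `v ∈ W₀ ∩ W₁`:
`v ∈ D(z₀) ↔ v ∈ D(z₁)`. (On a small principal chart `B ∋ v` for `y₁` inside `W₀ ∩ W₁`, `π^*y₀ = c · π^*y₁` with `c` a unit and `π^*y₁` a
nonzerodivisor, so `z₀|_B · c = z₁|_B`.) For the R4c COVER step: the residual sections `u₀′^{n₀}/cⱼ` (pinned to `π^*x₀^{n₀}`) and `t̂ⁿ/cⱼ` (pinned to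
`π^*tⁿ`) of two producer charts at the same point vanish at the same points of the overlap. [OURS · L1 W4.5c · R4c; folklore] -/
theorem mem_basicOpen_iff_of_pins {y₀ y₁ s : Γ(X, U)} (hy₀ : y₀ ∈ I.ideal U) (hy₁ : y₁ ∈ I.ideal U)
    {W₀ W₁ : X'.Opens} (hW₀ : W₀ ≤ blowupChart π I U y₀) (hW₁ : W₁ ≤ blowupChart π I U y₁)
    (z₀ : Γ(X', W₀)) (z₁ : Γ(X', W₁))
    (hz₀ : z₀ * π.appLE U W₀ (hW₀.trans (blowupChart_le_preimage π I U y₀)) y₀ = π.appLE U W₀ (hW₀.trans (blowupChart_le_preimage π I U y₀)) s)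
    (hz₁ : z₁ * π.appLE U W₁ (hW₁.trans (blowupChart_le_preimage π I U y₁)) y₁ = π.appLE U W₁ (hW₁.trans (blowupChart_le_preimage π I U y₁)) s)
    {v : X'} (hv₀ : v ∈ W₀) (hv₁ : v ∈ W₁) : v ∈ X'.basicOpen z₀ ↔ v ∈ X'.basicOpen z₁ := by
  -- a principal chart `B ∋ v` for `y₁` inside `W₀ ∩ W₁`; it is a principal chart for `y₀` as well
  obtain ⟨B, hB₁, hvB, hBle⟩ := exists_isPrincipalChart_le_of_mem (hW₁ hv₁) (O := W₀ ⊓ W₁) ⟨hv₀, hv₁⟩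
  have hB₀' : (B : X'.Opens) ≤ W₀ := fun x hx => (hBle hx).1
  have hB₁' : (B : X'.Opens) ≤ W₁ := fun x hx => (hBle hx).2
  have hB₀ : IsPrincipalChart π I U y₀ B := (hπ.isPrincipalChart_blowupChart hy₀).of_le (hB₀'.trans hW₀)
  obtain ⟨c, hc⟩ := hB₁.exists_eq_mul hy₀
  have hcu : IsUnit c := isUnit_ratio_of_isPrincipalChart_pair U hy₁ hB₁ hB₀ hc
  obtain ⟨h₁, hnzd, -⟩ := id hB₁
  -- restrict the two pins to `B`
  have e₀ : X'.presheaf.map (homOfLE hB₀').op z₀ * π.appLE U B h₁ y₀ = π.appLE U B h₁ s := by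
    have := congrArg (X'.presheaf.map (homOfLE hB₀').op) hz₀
    rw [map_mul, map_appLE_eq (hW₀.trans (blowupChart_le_preimage π I U y₀)) hB₀' y₀,
      map_appLE_eq (hW₀.trans (blowupChart_le_preimage π I U y₀)) hB₀' s] at this
    exact this
  have e₁ : X'.presheaf.map (homOfLE hB₁').op z₁ * π.appLE U B h₁ y₁ = π.appLE U B h₁ s := by
    have := congrArg (X'.presheaf.map (homOfLE hB₁').op) hz₁
    rw [map_mul, map_appLE_eq (hW₁.trans (blowupChart_le_preimage π I U y₁)) hB₁' y₁,
      map_appLE_eq (hW₁.trans (blowupChart_le_preimage π I U y₁)) hB₁' s] at this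
    exact this
  -- `z₀|_B · c · π^*y₁ = π^*s = z₁|_B · π^*y₁`, and `π^*y₁` is a nonzerodivisor on `B`
  have heq : X'.presheaf.map (homOfLE hB₀').op z₀ * c = X'.presheaf.map (homOfLE hB₁').op z₁ := by
    refine (mul_cancel_right_mem_nonZeroDivisors hnzd).mp ?_
    rw [mul_assoc, ← hc, e₀, e₁]
  have key : X'.basicOpen (X'.presheaf.map (homOfLE hB₀').op z₀) = X'.basicOpen (X'.presheaf.map (homOfLE hB₁').op z₁) := by
    rw [← heq, Scheme.basicOpen_mul, X'.basicOpen_of_isUnit hcu, inf_eq_left.mpr (X'.basicOpen_le _)]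
  rw [Scheme.basicOpen_res, Scheme.basicOpen_res] at key
  constructor
  · intro h
    have h' : v ∈ (B : X'.Opens) ⊓ X'.basicOpen z₀ := ⟨hvB, h⟩
    rw [key] at h'
    exact h'.2
  · intro h
    have h' : v ∈ (B : X'.Opens) ⊓ X'.basicOpen z₁ := ⟨hvB, h⟩
    rw [← key] at h'
    exact h'.2

/-- ★ **A point of `W ⊆ X′[U, y₁]` at which the pinned ratio `z = y₀/y₁` is invertible lies in `X′[U, y₀]`** (converse of
✓`mem_basicOpen_of_mem_blowupChart_of_mul_appLE_eq`): on a small principal chart `B ∋ v` for `y₁` inside `W ∩ D(z)` one has `π^*y₀ = z|_B · π^*y₁` with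
`z|_B` a unit, so `π^*y₀` is again a nonzerodivisor generating `I·𝒪(B)`, i.e. `B` is a principal chart for `y₀`. For the R4c COVER step: a residual point
of the producer chart `O′₀₂` at which the transition section towards `O′₀₁` does not vanish lies in `O′₀₁`. [OURS · L1 W4.5c · R4c; folklore, Stacks 0804] -/
theorem mem_blowupChart_of_mem_basicOpen_of_mul_appLE_eq {y₀ y₁ : Γ(X, U)}
    {W : X'.Opens} (hW : W ≤ blowupChart π I U y₁) (z : Γ(X', W))
    (hz : z * π.appLE U W (hW.trans (blowupChart_le_preimage π I U y₁)) y₁ = π.appLE U W (hW.trans (blowupChart_le_preimage π I U y₁)) y₀)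
    {v : X'} (hvW : v ∈ W) (hvz : v ∈ X'.basicOpen z) : v ∈ blowupChart π I U y₀ := by
  -- a principal chart `B ∋ v` for `y₁` inside `W ∩ D(z)`
  obtain ⟨B, hB₁, hvB, hBle⟩ := exists_isPrincipalChart_le_of_mem (hW hvW) (O := W ⊓ X'.basicOpen z) ⟨hvW, hvz⟩
  have hBW : (B : X'.Opens) ≤ W := fun x hx => (hBle hx).1
  have hBz : (B : X'.Opens) ≤ X'.basicOpen z := fun x hx => (hBle hx).2
  obtain ⟨h₁, hnzd, hideal⟩ := id hB₁
  -- `z|_B` is a unit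
  have hzu : IsUnit (X'.presheaf.map (homOfLE hBW).op z) := by
    have hres : X'.presheaf.map (homOfLE hBz).op (X'.presheaf.map (homOfLE (X'.basicOpen_le z)).op z) = X'.presheaf.map (homOfLE hBW).op z := by
      rw [← CommRingCat.comp_apply, ← X'.presheaf.map_comp]
      rfl
    rw [← hres]
    exact (AlgebraicGeometry.RingedSpace.isUnit_res_basicOpen X'.toLocallyRingedSpace.toRingedSpace z).map _
  -- the pin restricted to `B`: `π^*y₀ = z|_B · π^*y₁`
  have e : π.appLE U B h₁ y₀ = X'.presheaf.map (homOfLE hBW).op z * π.appLE U B h₁ y₁ := by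
    have := congrArg (X'.presheaf.map (homOfLE hBW).op) hz
    rw [map_mul, map_appLE_eq (hW.trans (blowupChart_le_preimage π I U y₁)) hBW y₁,
      map_appLE_eq (hW.trans (blowupChart_le_preimage π I U y₁)) hBW y₀] at this
    exact this.symm
  -- hence `B` is a principal chart for `y₀`
  have hB₀ : IsPrincipalChart π I U y₀ B := by
    refine ⟨h₁, ?_, ?_⟩
    · rw [e]
      exact mul_mem (IsUnit.mem_nonZeroDivisors hzu) hnzd
    · rw [hideal, e]
      exact (Ideal.span_singleton_mul_left_unit hzu _).symm
  exact hB₀.le_blowupChart hvB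

end Summit.ResolutionOfSingularities.ResolutionOfSingularities.Theorems.WildQuotientResolution.S1.BlowupCharts

end
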